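import Summits.NavierStokesRegularity.NavierStokesRegularity.Theses.AxisymmetricExtremality
import Summits.NavierStokesRegularity.NavierStokesRegularity.Theorems.AxisymmetricExtremalityAxisymmetricKatoGlobalNoSwirlStratum
import HarnessLib

/-!
# Strategist census s14-g2 — typed attempts for the crux `AxisymmetricKatoGlobal` (stmt-NavierStokesRegularity-15453)

Scratch file of the SECOND, INDEPENDENT strategy census (family `-s`, gen 2) for the crux
`AxisymmetricExtremality.AxisymmetricKatoGlobal` (AX_H).  Everything here is sorry-free LOGIC over the
route file and landed theorems; no analytic content is claimed.  It types the "weakest intermediate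
that could replace the crux in `closes`" and the route's own Smith-lever pushed one step (mirror
symmetry), and records that both are the crux's threshold restatement / a costume of it:

* `NoAxisymMinimalBlowup` (W₀) — «no axisymmetric Rusin–Šverák minimal blow-up datum»;
  `closes_of_noAxisymMinimalBlowup` — W₀ serves the route's deciding theorem verbatim in place of AX_H;
  `noAxisymMinimalBlowup_of_axisymmetricKatoGlobal` — AX_H ⇒ W₀ (W₀ is the weakest replacement).
* `IsMirrorSymmetric`, `hasNoSwirl_of_isAxisymmetric_of_isMirrorSymmetric` — an axisymmetric field
  that is also equivariant under the reflection `(x₀,x₁,x₂) ↦ (x₀,−x₁,x₂)` is swirl-free (elementary);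
  `MirrorExtremality` — «an axisymmetric minimal blow-up datum can be upgraded to a mirror-symmetric
  one» (the O(2)-version of the route's p-fold Smith lever);
  `mirrorExtremality_iff_noAxisymMinimalBlowup` — over the landed swirl-free stratum
  (`NoSwirlStratum.hasGlobalKatoSolution_of_isAxisymmetric_hasNoSwirl_viscosity`) MirrorExtremality is
  EQUIVALENT to W₀, i.e. a costume, not a strictly weaker intermediate.
-/

noncomputable section

open Set MeasureTheory Filter Topology Function
open scoped ENNReal NNReal
open Literature.Analysis.FluidPDE

namespace Summit.NavierStokesRegularity.NavierStokesRegularity.Cruxes.AxisymmetricKatoGlobal.StrategistS14g2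

open Summit.NavierStokesRegularity.NavierStokesRegularity.Theses.AxisymmetricExtremality
open Summit.NavierStokesRegularity.NavierStokesRegularity.Theorems.AxisymmetricKatoGlobal.NoSwirlStratum

local notation "ℝ³" => EuclideanSpace ℝ (Fin 3)
local notation "ℂ³" => EuclideanSpace ℂ (Fin 3)

/-! ### (1) The weakest intermediate serving `closes`: no axisymmetric minimal blow-up datum -/

/-- **W₀.** For every viscosity, no Rusin–Šverák `Ḣ^{1/2}`-minimal blow-up datum is axisymmetric.
This is exactly what `AxisymmetricExtremality.closes` consumes from AX_H (it applies AX_H only to the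
axisymmetric minimal datum produced by `PFoldToAxisymmetric ∘ MinimalDatumPFold`). -/
def NoAxisymMinimalBlowup : Prop :=
  ∀ ν : ℝ, 0 < ν → ∀ (u₀ : ℝ³ → ℝ³) (g : Literature.Analysis.FunctionSpaces.HomSobolev ℝ³ ℂ³ (1 / 2 : ℝ)),
    IsMinimalBlowupDatum ν u₀ g → IsAxisymmetric u₀ → False

/-- W₀ replaces AX_H in the route's deciding theorem (same two other cruxes, same pure-logic glue). -/
theorem closes_of_noAxisymMinimalBlowup (h₂ : MinimalDatumPFold) (h₄ : PFoldToAxisymmetric)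
    (hW : NoAxisymMinimalBlowup) : NavierStokesRegularity := by
  show Literature.NS.NavierStokesExistenceSmoothR3
  intro ν hν u₀ hsm hdiv hdec
  by_contra hno
  obtain ⟨u₁, g, hmin, hax⟩ := h₄ ν hν (h₂ ν hν ⟨u₀, hsm, hdiv, hdec, hno⟩)
  exact hW ν hν u₁ g hmin (fun θ x => hax θ x)

/-- AX_H ⇒ W₀: the crux implies the weakest replacement (so W₀ is genuinely the bottom of the ladder
of statements that serve `closes`). -/
theorem noAxisymMinimalBlowup_of_axisymmetricKatoGlobal (h : AxisymmetricKatoGlobal) :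
    NoAxisymMinimalBlowup := by
  intro ν hν u₀ g hmin hax
  obtain ⟨hL3, hrep, hdiv, -, hnot⟩ := hmin
  exact hnot (h ν hν u₀ g hL3 hrep hdiv (fun θ x => hax θ x))

/-! ### (1b) The route's Smith lever pushed to O(2): mirror symmetry kills the swirl -/

/-- Reflection in the meridian plane `{x₁ = 0}`: `(x₀, x₁, x₂) ↦ (x₀, −x₁, x₂)`. -/
def mirrorY (x : ℝ³) : ℝ³ := WithLp.toLp 2 ![x 0, -x 1, x 2]

@[simp] theorem mirrorY_apply_zero (x : ℝ³) : mirrorY x 0 = x 0 := rfl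
@[simp] theorem mirrorY_apply_one (x : ℝ³) : mirrorY x 1 = -x 1 := rfl
@[simp] theorem mirrorY_apply_two (x : ℝ³) : mirrorY x 2 = x 2 := rfl

/-- Equivariance of a vector field under the meridian reflection: `u (σ x) = σ (u x)`. -/
def IsMirrorSymmetric (u : ℝ³ → ℝ³) : Prop :=
  ∀ x, u (mirrorY x) = mirrorY (u x)

/-- **Elementary symmetry lemma.** An axisymmetric vector field that is also equivariant under one
meridian reflection has no swirl (`Γ = x₀u₁ − x₁u₀ ≡ 0`): the reflection reverses `Γ`, while a
rotation by twice the polar angle maps `σ x` back to `x` and preserves `Γ`. Proof by pure algebra on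
the fixed-point equation `u x = R_θ σ (u x)` with `cos θ = (x₀²−x₁²)/r²`, `sin θ = 2x₀x₁/r²`. -/
theorem hasNoSwirl_of_isAxisymmetric_of_isMirrorSymmetric {u : ℝ³ → ℝ³}
    (hax : IsAxisymmetric u) (hmi : IsMirrorSymmetric u) : HasNoSwirl u := by
  intro x
  by_cases hr : x 0 ^ 2 + x 1 ^ 2 = 0
  · have h0 : x 0 = 0 := by nlinarith [sq_nonneg (x 0), sq_nonneg (x 1)]
    have h1 : x 1 = 0 := by nlinarith [sq_nonneg (x 0), sq_nonneg (x 1)]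
    simp [swirl, h0, h1]
  · -- the angle θ with cos θ = (x₀²−x₁²)/r², sin θ = 2x₀x₁/r²
    set a : ℝ := x 0 ^ 2 - x 1 ^ 2 with ha
    set b : ℝ := 2 * x 0 * x 1 with hb
    have hnorm : a ^ 2 + b ^ 2 = (x 0 ^ 2 + x 1 ^ 2) ^ 2 := by rw [ha, hb]; ring
    have hr2 : (x 0 ^ 2 + x 1 ^ 2) ^ 2 ≠ 0 := pow_ne_zero 2 hr
    set z : ℂ := ⟨a, b⟩ with hz
    have hz0 : z ≠ 0 := by
      intro h
      have hre : a = 0 := by simpa [hz] using congrArg Complex.re h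
      have him : b = 0 := by simpa [hz] using congrArg Complex.im h
      apply hr2
      rw [← hnorm, hre, him]; ring
    have hzn : ‖z‖ = x 0 ^ 2 + x 1 ^ 2 := by
      have h1 : ‖z‖ ^ 2 = (x 0 ^ 2 + x 1 ^ 2) ^ 2 := by
        rw [Complex.sq_norm, Complex.normSq_apply, hz]; simp only []; nlinarith [hnorm]
      have hpos : 0 ≤ x 0 ^ 2 + x 1 ^ 2 := by positivity
      nlinarith [norm_nonneg z, sq_nonneg (‖z‖ - (x 0 ^ 2 + x 1 ^ 2)),
        sq_nonneg (‖z‖ + (x 0 ^ 2 + x 1 ^ 2))]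
    set θ : ℝ := Complex.arg z with hθ
    have hcos : Real.cos θ * (x 0 ^ 2 + x 1 ^ 2) = a := by
      have := Complex.cos_arg hz0
      rw [← hθ, hzn] at this
      rw [this, div_mul_cancel₀ _ hr]
    have hsin : Real.sin θ * (x 0 ^ 2 + x 1 ^ 2) = b := by
      have := Complex.sin_arg z
      rw [← hθ, hzn] at this
      rw [this, div_mul_cancel₀ _ hr]
    -- the fixed-point equation `u x = R_θ σ (u x)` from `R_θ (σ x) = x`
    have hfix : rotZ θ (mirrorY x) = x := by
      ext i
      fin_cases i
      · simp [rotZ, mirrorY]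
        have : (Real.cos θ * x 0 + Real.sin θ * x 1) * (x 0 ^ 2 + x 1 ^ 2) =
            x 0 * (x 0 ^ 2 + x 1 ^ 2) := by
          have e1 : (Real.cos θ * x 0 + Real.sin θ * x 1) * (x 0 ^ 2 + x 1 ^ 2)
              = (Real.cos θ * (x 0 ^ 2 + x 1 ^ 2)) * x 0 + (Real.sin θ * (x 0 ^ 2 + x 1 ^ 2)) * x 1 := by
            ring
          rw [e1, hcos, hsin, ha, hb]; ring
        have := mul_right_cancel₀ hr this
        linarith
      · simp [rotZ, mirrorY]
        have : (Real.sin θ * x 0 - Real.cos θ * x 1) * (x 0 ^ 2 + x 1 ^ 2) =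
            x 1 * (x 0 ^ 2 + x 1 ^ 2) := by
          have e1 : (Real.sin θ * x 0 - Real.cos θ * x 1) * (x 0 ^ 2 + x 1 ^ 2)
              = (Real.sin θ * (x 0 ^ 2 + x 1 ^ 2)) * x 0 - (Real.cos θ * (x 0 ^ 2 + x 1 ^ 2)) * x 1 := by
            ring
          rw [e1, hcos, hsin, ha, hb]; ring
        have := mul_right_cancel₀ hr this
        linarith
      · simp [rotZ, mirrorY]
    have hu : u x = rotZ θ (mirrorY (u x)) := by
      have := hax θ (mirrorY x)
      rw [hfix, hmi] at this
      exact this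
    -- components 0 and 1 of the fixed-point equation
    have e0 : u x 0 = Real.cos θ * u x 0 + Real.sin θ * u x 1 := by
      have := congrArg (fun v : ℝ³ => v 0) hu
      simpa [rotZ, mirrorY] using this
    have e1 : u x 1 = Real.sin θ * u x 0 - Real.cos θ * u x 1 := by
      have := congrArg (fun v : ℝ³ => v 1) hu
      simpa [rotZ, mirrorY, sub_eq_add_neg] using this
    -- multiply by r² and substitute cos θ r² = a, sin θ r² = b
    have f0 : u x 0 * (x 0 ^ 2 + x 1 ^ 2) = a * u x 0 + b * u x 1 := by
      have := congrArg (fun s => s * (x 0 ^ 2 + x 1 ^ 2)) e0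
      simp only [] at this
      rw [this]; rw [← hcos, ← hsin]; ring
    have f1 : u x 1 * (x 0 ^ 2 + x 1 ^ 2) = b * u x 0 - a * u x 1 := by
      have := congrArg (fun s => s * (x 0 ^ 2 + x 1 ^ 2)) e1
      simp only [] at this
      rw [this]; rw [← hcos, ← hsin]; ring
    -- x₁·Γ = 0 and x₀·Γ = 0, hence Γ = 0 off the axis
    have g0 : x 1 * (x 0 * u x 1 - x 1 * u x 0) = 0 := by
      rw [ha, hb] at f0; nlinarith [f0]
    have g1 : x 0 * (x 0 * u x 1 - x 1 * u x 0) = 0 := by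
      rw [ha, hb] at f1; nlinarith [f1]
    show swirl u x = 0
    unfold swirl
    have : (x 0 ^ 2 + x 1 ^ 2) * (x 0 * u x 1 - x 1 * u x 0) = 0 := by
      have e : (x 0 ^ 2 + x 1 ^ 2) * (x 0 * u x 1 - x 1 * u x 0)
          = x 0 * (x 0 * (x 0 * u x 1 - x 1 * u x 0)) + x 1 * (x 1 * (x 0 * u x 1 - x 1 * u x 0)) := by
        ring
      rw [e, g0, g1]; ring
    rcases mul_eq_zero.1 this with h | h
    · exact absurd h hr
    · linarith

/-- **MirrorExtremality** — the route's Smith lever (crux `MinimalDatumPFold`: arbitrarily high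
p-fold symmetry of SOME minimal datum; crux `PFoldToAxisymmetric`: hence an axisymmetric one) pushed
from `SO(2)` to `O(2)`: an axisymmetric minimal blow-up datum can be upgraded to one that is also
equivariant under a meridian reflection. -/
def MirrorExtremality : Prop :=
  ∀ ν : ℝ, 0 < ν → ∀ (u₀ : ℝ³ → ℝ³) (g : Literature.Analysis.FunctionSpaces.HomSobolev ℝ³ ℂ³ (1 / 2 : ℝ)),
    IsMinimalBlowupDatum ν u₀ g → IsAxisymmetric u₀ →
    ∃ (u₁ : ℝ³ → ℝ³) (g₁ : Literature.Analysis.FunctionSpaces.HomSobolev ℝ³ ℂ³ (1 / 2 : ℝ)),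
      IsMinimalBlowupDatum ν u₁ g₁ ∧ IsAxisymmetric u₁ ∧ IsMirrorSymmetric u₁

/-- **Costume certificate.** Over the landed swirl-free stratum, MirrorExtremality is EQUIVALENT to W₀:
(⇒) a mirror-symmetric axisymmetric minimal datum is swirl-free, hence has a global Kato solution
(`hasGlobalKatoSolution_of_isAxisymmetric_hasNoSwirl_viscosity`), contradicting minimality's
`¬ HasGlobalKatoSolution`; (⇐) vacuous.  So MirrorExtremality is not a strictly weaker intermediate. -/
theorem mirrorExtremality_iff_noAxisymMinimalBlowup : MirrorExtremality ↔ NoAxisymMinimalBlowup := by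
  constructor
  · intro hM ν hν u₀ g hmin hax
    obtain ⟨u₁, g₁, hmin₁, hax₁, hmi₁⟩ := hM ν hν u₀ g hmin hax
    obtain ⟨hL3, -, hdiv, -, hnot⟩ := hmin₁
    exact hnot (hasGlobalKatoSolution_of_isAxisymmetric_hasNoSwirl_viscosity hν hL3 hdiv hax₁
      (hasNoSwirl_of_isAxisymmetric_of_isMirrorSymmetric hax₁ hmi₁))
  · intro hW ν hν u₀ g hmin hax
    exact (hW ν hν u₀ g hmin hax).elim

/-- Hence MirrorExtremality also serves `closes` — but only because it is W₀ in costume. -/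
theorem closes_of_mirrorExtremality (h₂ : MinimalDatumPFold) (h₄ : PFoldToAxisymmetric)
    (hM : MirrorExtremality) : NavierStokesRegularity :=
  closes_of_noAxisymMinimalBlowup h₂ h₄ (mirrorExtremality_iff_noAxisymMinimalBlowup.1 hM)

end Summit.NavierStokesRegularity.NavierStokesRegularity.Cruxes.AxisymmetricKatoGlobal.StrategistS14g2

end
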